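import Summits.QuantumAdvantage.QuantumAdvantage.Theorems.CubicForrelationNearExactIsExactCubicFormR4ZLeafSlices
import Summits.QuantumAdvantage.QuantumAdvantage.Theorems.CubicForrelationNearExactIsExactCubicFormR4ZLeafInv
import Summits.QuantumAdvantage.QuantumAdvantage.Theorems.CubicForrelationNearExactIsExactCubicFormTensor
import Summits.QuantumAdvantage.QuantumAdvantage.Theorems.CubicForrelationNearExactIsExactTwelvePartnerR4LeafZ

/-!
# Crux `CubicForrelation.NearExactIsExact` (stmt-QuantumAdvantage-14043) — E1280-even, R4 branch, the d-level leaf of descendant `0`: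
  the NORMAL FORM and the two radical ranks `rank Ξ ∈ {4, 6}`

Certificate seat `b2b-cforr-cert` (gen 43).  HONEST FRAMING: kernel-checked assembly (standard axioms).  `tq5_leaf_rank`: the data of the
leaf statement `HLEAF` of …CubicFormR4ZReduce (partner pair `(c, d)`, `d(y,·,·) = v₀v₁ + v₂v₃`, `d|_{z³} = 0`, `d(v_t,z,z) = a_t Ξ`,
`d(v_t,v_t',z) = ω_tt'E + a_tM_t' + a_t'M_t`), a symplectic `v`-frame adapted to `a` (…CubicFormR4ZLeafSp) and `z`-coordinates in
which `Ξ = ω_{2h}` with `h ∈ {2, 3}` (…CubicFormR4ZLeafXi) are contradictory: transport `(c, d)` by the block frame of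
…CubicFormR4ZLeafFrame (`tcx_transport_hyps`, `tps_pair_covariant`, inverse …CubicFormR4ZLeafInv), read off the slices
(…CubicFormR4ZLeafSlices) and apply `tpa_R4_Z_rank4` / `tpa_R4_Z_rank6` (…TwelvePartnerR4LeafZ, cert seat g39).  The ranks `0, 2`
(kernel vector) are …CubicFormR4ZLeafKer.  Nothing about `θ₁₂` by itself; NOT summit progress.

References: this seat lineage (g39 HANDPROOFS §2.4, g43 LEAN-GEN43).  Axioms: the standard three.
-/

set_option linter.dupNamespace false -- D-0017: single-problem summit ⇒ `QuantumAdvantage.QuantumAdvantage` by design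

namespace Summit.QuantumAdvantage.QuantumAdvantage.Theorems.CubicForrelation.NearExactIsExact

open Finset

/-- **The leaf for `rank Ξ ∈ {4, 6}`.**  See the module docstring. [this work] -/
theorem tq5_leaf_rank (c d : Fin (5 + 7) → Fin (5 + 7) → Fin (5 + 7) → ZMod 2) (hcs : ∀ p j k, c p k j = c p j k) (hcc : ∀ p j k, c j p k = c p j k) (hcd : ∀ p j, c p j j = 0)
    (hds : ∀ φ j k, d φ k j = d φ j k) (hdc : ∀ φ j k, d j φ k = d φ j k) (hdd : ∀ φ j, d φ j j = 0)
    (hpair : ∀ p φ, (∑ j, ∑ k, (if j < k then c p j k * d φ j k else 0)) = if p = φ then 1 else 0)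
    (hF : ∀ j k, d (Fin.castAdd 7 (0 : Fin 5)) j k =
      (if (j = Fin.castAdd 7 (1 : Fin 5) ∧ k = Fin.castAdd 7 (2 : Fin 5)) ∨ (j = Fin.castAdd 7 (2 : Fin 5) ∧ k = Fin.castAdd 7 (1 : Fin 5)) then 1 else 0) +
      (if (j = Fin.castAdd 7 (3 : Fin 5) ∧ k = Fin.castAdd 7 (4 : Fin 5)) ∨ (j = Fin.castAdd 7 (4 : Fin 5) ∧ k = Fin.castAdd 7 (3 : Fin 5)) then 1 else 0))
    (hzzz : ∀ σ τ υ : Fin 7, d (Fin.natAdd 5 σ) (Fin.natAdd 5 τ) (Fin.natAdd 5 υ) = 0) (a : Fin 4 → ZMod 2) (Ξ : Fin 7 → Fin 7 → ZMod 2)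
    (hdΞ : ∀ (t : Fin 4) (j k : Fin 7), d (Fin.castAdd 7 t.succ) (Fin.natAdd 5 j) (Fin.natAdd 5 k) = a t * Ξ j k)
    (E : Fin 7 → ZMod 2) (M : Fin 4 → Fin 7 → ZMod 2)
    (hdL : ∀ (t t' : Fin 4) (j : Fin 7), d (Fin.castAdd 7 t.succ) (Fin.castAdd 7 t'.succ) (Fin.natAdd 5 j) =
      ((if (t = 0 ∧ t' = 1) ∨ (t = 1 ∧ t' = 0) then (1 : ZMod 2) else 0) + (if (t = 2 ∧ t' = 3) ∨ (t = 3 ∧ t' = 2) then (1 : ZMod 2) else 0)) * E j + a t * M t' j + a t' * M t j)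
    (B Bi : Fin 4 → Fin 4 → ZMod 2)
    (hBω' : ∀ i i' : Fin 4, (∑ t : Fin 4, ∑ t' : Fin 4, B t i * B t' i' * ((if (t = 0 ∧ t' = 1) ∨ (t = 1 ∧ t' = 0) then (1 : ZMod 2) else 0) + (if (t = 2 ∧ t' = 3) ∨ (t = 3 ∧ t' = 2) then (1 : ZMod 2) else 0))) = ((if (i = 0 ∧ i' = 1) ∨ (i = 1 ∧ i' = 0) then (1 : ZMod 2) else 0) + (if (i = 2 ∧ i' = 3) ∨ (i = 3 ∧ i' = 2) then (1 : ZMod 2) else 0)))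
    (hBa' : ∀ i : Fin 4, (∑ t : Fin 4, a t * B t i) = if i = 0 then 1 else 0)
    (hBiB' : ∀ i t : Fin 4, (∑ s : Fin 4, Bi i s * B s t) = if i = t then 1 else 0)
    (R Ri : Fin 7 → Fin 7 → ZMod 2) (hRiR' : ∀ j k, (∑ s, Ri j s * R s k) = if j = k then 1 else 0)
    (h : ℕ) (hh : h = 2 ∨ h = 3)
    (hRΞ : ∀ s u : Fin 7, (∑ m, ∑ m', Ξ m m' * R m s * R m' u) =
        ∑ i : Fin h, ((if s.val = i.val then (1 : ZMod 2) else 0) * (if u.val = h + i.val then (1 : ZMod 2) else 0) +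
          (if s.val = h + i.val then (1 : ZMod 2) else 0) * (if u.val = i.val then (1 : ZMod 2) else 0))) : False := by
  classical
  -- the frames as column functions
  obtain ⟨BC, hBC⟩ : ∃ BC : Fin 4 → Fin 4 → ZMod 2, ∀ i t, BC i t = B t i := ⟨fun i t => B t i, fun _ _ => rfl⟩
  obtain ⟨RC, hRC⟩ : ∃ RC : Fin 7 → Fin 7 → ZMod 2, ∀ s m, RC s m = R m s := ⟨fun s m => R m s, fun _ _ => rfl⟩
  have hBω : ∀ i i' : Fin 4, (∑ t : Fin 4, ∑ t' : Fin 4, BC i t * BC i' t' * ((if (t = 0 ∧ t' = 1) ∨ (t = 1 ∧ t' = 0) then (1 : ZMod 2) else 0) + (if (t = 2 ∧ t' = 3) ∨ (t = 3 ∧ t' = 2) then (1 : ZMod 2) else 0))) = ((if (i = 0 ∧ i' = 1) ∨ (i = 1 ∧ i' = 0) then (1 : ZMod 2) else 0) + (if (i = 2 ∧ i' = 3) ∨ (i = 3 ∧ i' = 2) then (1 : ZMod 2) else 0)) := by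
    intro i i'; simp only [hBC]; exact hBω' i i'
  have hBa : ∀ i : Fin 4, (∑ t : Fin 4, a t * BC i t) = if i = 0 then 1 else 0 := by
    intro i; simp only [hBC]; exact hBa' i
  have hBiB : ∀ i i' : Fin 4, (∑ t : Fin 4, Bi i t * BC i' t) = if i = i' then 1 else 0 := by
    intro i i'; simp only [hBC]; exact hBiB' i i'
  have hRiR : ∀ j j' : Fin 7, (∑ k : Fin 7, Ri j k * RC j' k) = if j = j' then 1 else 0 := by
    intro j j'; simp only [hRC]; exact hRiR' j j'
  have hXR : ∀ s u : Fin 7, (∑ m : Fin 7, ∑ m' : Fin 7, Ξ m m' * RC s m * RC u m') =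
      ∑ i : Fin h, ((if s.val = i.val then (1 : ZMod 2) else 0) * (if u.val = h + i.val then (1 : ZMod 2) else 0) +
          (if s.val = h + i.val then (1 : ZMod 2) else 0) * (if u.val = i.val then (1 : ZMod 2) else 0)) := by
    intro s u; simp only [hRC]; exact hRΞ s u
  -- the shears
  obtain ⟨hqs, hqc, hqd⟩ := tcx_transport_hyps (fun q α γ => d (Fin.castAdd 7 (Fin.succ q)) (Fin.castAdd 7 (Fin.succ α)) (Fin.castAdd 7 (Fin.succ γ)))
    BC (fun q α γ => hds _ _ _) (fun q α γ => hdc _ _ _) (fun q α => hdd _ _)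
  obtain ⟨β, hβ⟩ := tq5_beta_exists (fun i i' i'' => (∑ t : Fin 4, ∑ t' : Fin 4, ∑ t'' : Fin 4, BC i t * BC i' t' * BC i'' t'' * d (Fin.castAdd 7 (Fin.succ t)) (Fin.castAdd 7 (Fin.succ t')) (Fin.castAdd 7 (Fin.succ t'')))) hqs hqc hqd
  obtain ⟨ε, hε⟩ : ∃ ε : Fin 7 → ZMod 2, ∀ s : Fin 7, (∑ j : Fin 7, E j * RC s j) = ε s := ⟨_, fun _ => rfl⟩
  -- the frame and its inverse
  obtain ⟨P, hP0, hPv, hPz⟩ : ∃ P : Fin (5 + 7) → Fin (5 + 7) → ZMod 2, (∀ ψ, P ψ (Fin.castAdd 7 (0 : Fin 5)) = (Fin.append (Fin.cons (1) ((0 : Fin 4 → ZMod 2)) : Fin 5 → ZMod 2) ((0 : Fin 7 → ZMod 2)) : Fin (5 + 7) → ZMod 2) ψ) ∧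
      (∀ ψ (i : Fin 4), P ψ (Fin.castAdd 7 (Fin.succ i)) = (Fin.append (Fin.cons (β i) (BC i) : Fin 5 → ZMod 2) ((0 : Fin 7 → ZMod 2)) : Fin (5 + 7) → ZMod 2) ψ) ∧
      (∀ ψ (j : Fin 7), P ψ (Fin.natAdd 5 j) = (Fin.append (Fin.cons (ε j) ((0 : Fin 4 → ZMod 2)) : Fin 5 → ZMod 2) (RC j) : Fin (5 + 7) → ZMod 2) ψ) :=
    ⟨fun ψ φ => Fin.append (Fin.cons ((Fin.append (Fin.cons (1) ((0 : Fin 4 → ZMod 2)) : Fin 5 → ZMod 2) ((0 : Fin 7 → ZMod 2)) : Fin (5 + 7) → ZMod 2) ψ) (fun i => (Fin.append (Fin.cons (β i) (BC i) : Fin 5 → ZMod 2) ((0 : Fin 7 → ZMod 2)) : Fin (5 + 7) → ZMod 2) ψ) : Fin 5 → ZMod 2) (fun j => (Fin.append (Fin.cons (ε j) ((0 : Fin 4 → ZMod 2)) : Fin 5 → ZMod 2) (RC j) : Fin (5 + 7) → ZMod 2) ψ) φ,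
      fun ψ => by simp only [Fin.append_left, Fin.cons_zero], fun ψ i => by simp only [Fin.append_left, Fin.cons_succ],
      fun ψ j => by simp only [Fin.append_right]⟩
  obtain ⟨Pinv, hPi0, hPiv, hPiz⟩ : ∃ Pinv : Fin (5 + 7) → Fin (5 + 7) → ZMod 2, (∀ ψ, Pinv (Fin.castAdd 7 (0 : Fin 5)) ψ =
      (Fin.append (Fin.cons (1) ((fun t => ∑ i : Fin 4, β i * Bi i t)) : Fin 5 → ZMod 2) ((fun k => ∑ j : Fin 7, ε j * Ri j k)) : Fin (5 + 7) → ZMod 2) ψ) ∧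
      (∀ (i : Fin 4) ψ, Pinv (Fin.castAdd 7 (Fin.succ i)) ψ = (Fin.append (Fin.cons (0) (Bi i) : Fin 5 → ZMod 2) ((0 : Fin 7 → ZMod 2)) : Fin (5 + 7) → ZMod 2) ψ) ∧
      (∀ (j : Fin 7) ψ, Pinv (Fin.natAdd 5 j) ψ = (Fin.append (Fin.cons (0) ((0 : Fin 4 → ZMod 2)) : Fin 5 → ZMod 2) (Ri j) : Fin (5 + 7) → ZMod 2) ψ) :=
    ⟨fun φ ψ => Fin.append (Fin.cons ((Fin.append (Fin.cons (1) ((fun t => ∑ i : Fin 4, β i * Bi i t)) : Fin 5 → ZMod 2) ((fun k => ∑ j : Fin 7, ε j * Ri j k)) : Fin (5 + 7) → ZMod 2) ψ) (fun i => (Fin.append (Fin.cons (0) (Bi i) : Fin 5 → ZMod 2) ((0 : Fin 7 → ZMod 2)) : Fin (5 + 7) → ZMod 2) ψ) : Fin 5 → ZMod 2) (fun j => (Fin.append (Fin.cons (0) ((0 : Fin 4 → ZMod 2)) : Fin 5 → ZMod 2) (Ri j) : Fin (5 + 7) → ZMod 2) ψ) φ,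
      fun ψ => by simp only [Fin.append_left, Fin.cons_zero], fun i ψ => by simp only [Fin.append_left, Fin.cons_succ],
      fun j ψ => by simp only [Fin.append_right]⟩
  have hinv := tq5_frame_inv BC Bi RC Ri β ε P Pinv hP0 hPv hPz hPi0 hPiv hPiz hBiB hRiR
  have hPiP : (Matrix.of fun i j => Pinv i j) * (Matrix.of fun i j => P i j) = 1 :=
    Matrix.ext fun i j => by rw [Matrix.mul_apply, Matrix.one_apply]; simp only [Matrix.of_apply]; exact hinv i j
  -- the transported pair
  obtain ⟨d', hd'⟩ : ∃ d' : Fin (5 + 7) → Fin (5 + 7) → Fin (5 + 7) → ZMod 2, ∀ φ j k, d' φ j k = (∑ ψ, ∑ α, ∑ β', P ψ φ * P α j * P β' k * d ψ α β') :=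
    ⟨_, fun _ _ _ => rfl⟩
  obtain ⟨c', hc'⟩ : ∃ c' : Fin (5 + 7) → Fin (5 + 7) → Fin (5 + 7) → ZMod 2, ∀ p j k, c' p j k = (∑ q, ∑ α, ∑ β', Pinv p q * Pinv j α * Pinv k β' * c q α β') :=
    ⟨_, fun _ _ _ => rfl⟩
  obtain ⟨hds0, hdc0, hdd0⟩ := tcx_transport_hyps_form d P hds hdc hdd
  have hds' : ∀ φ j k, d' φ k j = d' φ j k := fun φ j k => by rw [hd', hd']; exact hds0 φ j k
  have hdc' : ∀ φ j k, d' j φ k = d' φ j k := fun φ j k => by rw [hd', hd']; exact hdc0 φ j k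
  obtain ⟨hcs0, hcc0, hcd0⟩ := tcx_transport_hyps c Pinv hcs hcc hcd
  have hcs' : ∀ p j k, c' p k j = c' p j k := fun p j k => by rw [hc', hc']; exact hcs0 p j k
  have hcc' : ∀ p j k, c' j p k = c' p j k := fun p j k => by rw [hc', hc']; exact hcc0 p j k
  have hcd' : ∀ p j, c' p j j = 0 := fun p j => by rw [hc']; exact hcd0 p j
  have hpair' : ∀ p φ, (∑ j, ∑ k, (if j < k then c' p j k * d' φ j k else 0)) = if p = φ then 1 else 0 := by
    intro p φ
    have e := tps_pair_covariant c d hcs hcd hds hdd hpair (Matrix.of fun i j => P i j) (Matrix.of fun i j => Pinv i j) hPiP p φ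
    simp only [Matrix.of_apply] at e
    refine Eq.trans (sum_congr rfl fun j _ => sum_congr rfl fun k _ => ?_) e
    rw [hc', hd']
  -- the slices in the new frame
  have hdy_kk := tq5_s_dy_kk d hds hdc hdd hF hzzz a Ξ hdΞ E M hdL BC β P d' hd' hds' hP0 hPv hBω
  have hdy_ks := tq5_s_dy_ks d hds hdc hdd hF hzzz a Ξ hdΞ E M hdL BC RC β ε P d' hd' hP0 hPv hPz
  have hdy_ss := tq5_s_dy_ss d hds hdc hdd hF hzzz a Ξ hdΞ E M hdL RC ε P d' hd' hP0 hPz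
  have hdv0_kk := tq5_s_dv0_kk d hds hdc hdd hF hzzz a Ξ hdΞ E M hdL BC β P d' hd' hds' hdc' hP0 hPv hBω hβ
  have hdv0_ks := tq5_s_dv0_ks d hds hdc hdd hF hzzz a Ξ hdΞ E M hdL BC RC β ε P d' hd' hdc' hP0 hPv hPz hBω hBa hε
  have hdv0_ss := tq5_s_dv0_ss d hds hdc hdd hF hzzz a Ξ hdΞ E M hdL BC RC β ε P d' hd' hPv hPz hBa
  have hdv_kk := tq5_s_dv_kk d hds hdc hdd hF hzzz a Ξ hdΞ E M hdL BC β P d' hd' hds' hdc' hP0 hPv hBω hβ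
  have hdv_ks := tq5_s_dv_ks d hds hdc hdd hF hzzz a Ξ hdΞ E M hdL BC RC β ε P d' hd' hdc' hP0 hPv hPz hBω hBa hε
  have hdv_ss := tq5_s_dv_ss d hds hdc hdd hF hzzz a Ξ hdΞ E M hdL BC RC β ε P d' hd' hPv hPz hBa
  have hdz_kk := tq5_s_dz_kk d hds hdc hdd hF hzzz a Ξ hdΞ E M hdL BC RC β ε P d' hd' hds' hdc' hP0 hPv hPz hBω hBa hε
  have hdz_ks := tq5_s_dz_ks d hds hdc hdd hF hzzz a Ξ hdΞ E M hdL BC RC β ε P d' hd' hdc' hP0 hPv hPz hBa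
  have hdz_ss := tq5_s_dz_ss d hds hdc hdd hF hzzz a Ξ hdΞ E M hdL RC ε P d' hd' hPz
  -- the transported `Ξ' = Rᵀ Ξ R = ω_{2h}`
  rcases hh with rfl | rfl
  · have hX : ∀ s u : Fin 7, (∑ m : Fin 7, ∑ m' : Fin 7, Ξ m m' * RC s m * RC u m') = (if (s = 0 ∧ u = 2) ∨ (s = 2 ∧ u = 0) ∨ (s = 1 ∧ u = 3) ∨ (s = 3 ∧ u = 1) then (1 : ZMod 2) else 0) := by
      intro s u; rw [hXR s u]; revert s u; decide
    have hΞs' : ∀ j k : Fin 7, (∑ m : Fin 7, ∑ m' : Fin 7, Ξ m m' * RC k m * RC j m') = (∑ m : Fin 7, ∑ m' : Fin 7, Ξ m m' * RC j m * RC k m') := by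
      intro j k; rw [hX, hX]; revert j k; decide
    have hΞ4 : ∀ i : Fin 7, (∑ m : Fin 7, ∑ m' : Fin 7, Ξ m m' * RC i m * RC 4 m') = 0 := fun i => by rw [hX]; revert i; decide
    have hΞ5 : ∀ i : Fin 7, (∑ m : Fin 7, ∑ m' : Fin 7, Ξ m m' * RC i m * RC 5 m') = 0 := fun i => by rw [hX]; revert i; decide
    have hΞ6 : ∀ i : Fin 7, (∑ m : Fin 7, ∑ m' : Fin 7, Ξ m m' * RC i m * RC 6 m') = 0 := fun i => by rw [hX]; revert i; decide
    have hΞinj : ∀ w : Fin 7 → ZMod 2, (∀ j : Fin 7, (∑ s : Fin 7, (∑ m : Fin 7, ∑ m' : Fin 7, Ξ m m' * RC j m * RC s m') * w s) = 0) → w 0 = 0 ∧ w 1 = 0 ∧ w 2 = 0 ∧ w 3 = 0 := by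
      intro w hw
      have h0 := hw 2
      have h1 := hw 3
      have h2 := hw 0
      have h3 := hw 1
      simp only [hX] at h0 h1 h2 h3
      simp at h0 h1 h2 h3
      exact ⟨h0, h1, h2, h3⟩
    exact tpa_R4_Z_rank4 c' d' hcs' hcc' hcd' hpair' (fun s u => (∑ m : Fin 7, ∑ m' : Fin 7, Ξ m m' * RC s m * RC u m')) hΞs' (fun t s => (∑ q : Fin 4, ∑ r : Fin 7, M q r * BC (Fin.succ t) q * RC s r))
        hdy_kk hdy_ks hdy_ss hdv0_kk hdv0_ks hdv0_ss hdv_kk hdv_ks hdv_ss hdz_kk hdz_ks hdz_ss hΞ4 hΞ5 hΞ6 hΞinj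
  · have hX : ∀ s u : Fin 7, (∑ m : Fin 7, ∑ m' : Fin 7, Ξ m m' * RC s m * RC u m') = (if (s = 0 ∧ u = 3) ∨ (s = 3 ∧ u = 0) ∨ (s = 1 ∧ u = 4) ∨ (s = 4 ∧ u = 1) ∨ (s = 2 ∧ u = 5) ∨ (s = 5 ∧ u = 2) then (1 : ZMod 2) else 0) := by
      intro s u; rw [hXR s u]; revert s u; decide
    have hΞs' : ∀ j k : Fin 7, (∑ m : Fin 7, ∑ m' : Fin 7, Ξ m m' * RC k m * RC j m') = (∑ m : Fin 7, ∑ m' : Fin 7, Ξ m m' * RC j m * RC k m') := by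
      intro j k; rw [hX, hX]; revert j k; decide
    have hΞd' : ∀ i : Fin 7, (∑ m : Fin 7, ∑ m' : Fin 7, Ξ m m' * RC i m * RC i m') = 0 := fun i => by rw [hX]; revert i; decide
    have hΞ6 : ∀ i : Fin 7, (∑ m : Fin 7, ∑ m' : Fin 7, Ξ m m' * RC i m * RC 6 m') = 0 := fun i => by rw [hX]; revert i; decide
    have hΞinj : ∀ w : Fin 7 → ZMod 2, (∀ j : Fin 7, (∑ s : Fin 7, (∑ m : Fin 7, ∑ m' : Fin 7, Ξ m m' * RC j m * RC s m') * w s) = 0) → ∀ m : Fin 7, m ≠ 6 → w m = 0 := by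
      intro w hw m hm
      have h0 := hw 3
      have h1 := hw 4
      have h2 := hw 5
      have h3 := hw 0
      have h4 := hw 1
      have h5 := hw 2
      simp only [hX] at h0 h1 h2 h3 h4 h5
      simp at h0 h1 h2 h3 h4 h5
      have hm' : m = 0 ∨ m = 1 ∨ m = 2 ∨ m = 3 ∨ m = 4 ∨ m = 5 := by revert m; decide
      rcases hm' with rfl | rfl | rfl | rfl | rfl | rfl
      · exact h0
      · exact h1
      · exact h2
      · exact h3
      · exact h4
      · exact h5
    exact tpa_R4_Z_rank6 c' d' hcs' hcc' hcd' hpair' (fun s u => (∑ m : Fin 7, ∑ m' : Fin 7, Ξ m m' * RC s m * RC u m')) hΞs' (fun t s => (∑ q : Fin 4, ∑ r : Fin 7, M q r * BC (Fin.succ t) q * RC s r))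
        hdy_kk hdy_ks hdy_ss hdv0_kk hdv0_ks hdv0_ss hdv_kk hdv_ks hdv_ss hdz_kk hdz_ks hdz_ss hΞd' hΞ6 hΞinj

end Summit.QuantumAdvantage.QuantumAdvantage.Theorems.CubicForrelation.NearExactIsExact
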